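import Summits.QuantumFields.YangMills.Theorems.UV3PinnedStepOrganOfMassEnvelope
import Summits.QuantumFields.YangMills.Theorems.UV3UnitEnvelopeOrganOfMassEnvelopeV3
import HarnessLib

/-!
# R3 (cell `ym3-torus`, YM₃ on T³ — a ladder RUNG, NOT d = 4, NOT the Clay problem) — **R-19936-S OVER THE v3 SOCKET: THE ORGAN ROW (S-ii) `hSii` (✓p753361's binder,
# windowed pinned weights `wtP`) IS A THEOREM MODULO hJ(v3), THE TOP-LEVEL A.E. ENVELOPE OF THE PINNED TRANSPORTED MASSES** (★★OWNER WORD 58 (e): v3 = hJ's honest home)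

Seat `ym-ust-19936-w6` g7 (R526 (S) hand; LOCATE `LOCATE-S-ORGAN-w6g7.md` §4).  THEOREMS ONLY (0 `def`, 0 `sorry`); `--supports stmt-QuantumFields-19936 --as helper`; count-neutral;
CONDITIONAL on the v3 (α) socket `AlphaInputsT3AC.OfV3At F 𝔠 a₀ a₁` and on hJ(v3).  The v3 twin of ✓`UV3PinnedStepThroughOfMassEnvelope` §2 + ✓`UV3PinnedStepOrganOfMassEnvelope`
(`ym3-torus-px8` g11's v3 bricks ✓p752660∕✓p752960∕✓p753168∕✓p753361 fixed the (S-ii)ᵥ₃ letter: the v1 text with the masses `(h.pkgAtV3 hc γ hγ hγ1 K).wtP`).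

THE CHAIN BY KERNEL AFTER THIS FILE (v3 currency — the faces of record): `stub_pinnedStep` (v3 text) ⟸ ✓p749641 `UV3PinnedStepV3FaceOfPackageV3.stub_pinnedStepV3_of_packageV3_of_purePinTop
(hpkg : ∀ L > 1, ∃ 𝔠 a₀ a₁ …)(π)(hPinA)` ⟸ ✓p753361 `UV3PinnedStepKnitOfPackageV3.hPinA_of_pinnedLF_v3 (π)(hSii)` ⟸ **`hSii` = §3 `AlphaInputsT3AC.OfV3At.hSii_of_massEnvelope (hJ)`** — so
R-19936-S over the v3 socket displays EXACTLY hJ(v3) (letter: the U-v3 file ✓`UV3UnitEnvelopeOrganOfMassEnvelopeV3`; same row for U-v3: «counted once», no `hMain`, no `hTriv`).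

CONTENTS (at `p : AlphaInputsT3AC.PkgAtV3 F 𝔠 γ hγ hγ1 K`): §1 ★★★ `through_le_of_massEnvelope_v3` (FILE 1 ✓`largeField_enveloped_adm` (P) at the v3 package: weights `p.wtP`
(vanish off admissible ✓`PinnedStep.wtP_eq_zero_of_not_admissible`), small factors ✓`smallFactorsAdm_towerOfAC_v3`, Z-terms ✓`Zterm_towerOfAC_top_le_booked`, collar, progression,
provisos — as in the v1 prequel); §2 ★★★ `pinnedLF_le_of_massEnvelope_v3` (pure pin + collar branch; the mass-free ✓`restricted_sum_le_through_sums`, ✓`collar_scaleSum_le_at`,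
✓`pFun_sq_eq` of the v1 file BY NAME; decl-local `maxHeartbeats 400000`); §3 ★★★ `AlphaInputsT3AC.OfV3At.hSii_of_massEnvelope` — ✓p753361's `hSii` binder VERBATIM from hJ(v3)
(`A := 0`, `c := 1∕128`, `CZ := A₁ + (6∕log L)(2L^m)³ + log(1 + C_coll∕ℓ)`).

HONEST SCOPE.  Bookkeeping; hJ(v3) DISPLAYED, not proved; nothing of `stub_pinnedStep`, `stub_unitEnvelope`, `hP′`, `HistoryTailL` (19936), the rung, d = 4, a mass gap or Clay is
proved here; no summit statement is proved by this seat.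

References: T. Bałaban, Commun. Math. Phys. **102** (1985) 255–275 [Balaban1985UV3] ((38)–(41) p. 266, (67)–(71) p. 273, pp. 273–274, (7) p. 257, (5) p. 256).
-/

set_option autoImplicit false

noncomputable section

namespace Summit.QuantumFields.YangMills.Theorems.UV3PinnedStepOrganOfMassEnvelopeV3

open MeasureTheory
open scoped BigOperators
open Literature.MathematicalPhysics.QuantumFieldTheory.Balaban1983to89
open Literature.MathematicalPhysics.QuantumFieldTheory.Balaban1983to89.B10LargeField (xlog one_le_xlog pFun_eq xlog_gRun)
open Literature.MathematicalPhysics.QuantumFieldTheory.Balaban1983to89.T3ContinuumYM3Torus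
open Literature.MathematicalPhysics.QuantumFieldTheory.Balaban1983to89.T3UnitLawDensityEML (ℰp)
open Literature.MathematicalPhysics.QuantumFieldTheory.Balaban1985CMP102
open Literature.MathematicalPhysics.QuantumFieldTheory.Balaban1985CMP102.Setting
open Summit.QuantumFields.Balaban3D.Carriers
open Summit.QuantumFields.Balaban3D.Proofs.Primitives
open Summit.QuantumFields.Balaban3D.Proofs.ScalesArithmetic (gk_pos gk_le_one g0sq_pos gk_eq_gRun_norm)
open Summit.QuantumFields.Balaban3D.Proofs.Family (prov_hb₁ prov_hb₂ prov_hp)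
open Summit.QuantumFields.Balaban3D.Proofs.TowerAC
open Summit.QuantumFields.Balaban3D.Proofs.StandardAC
open Summit.QuantumFields.Balaban3D.Proofs.InputsAC
open Summit.QuantumFields.Balaban3D.Proofs.HistCount (card_filter_allCodes_le_exp)
open Summit.QuantumFields.Balaban3D.Proofs.LargeFieldStd (rcolOf_antitone rcolOf_le zcoefOf_le zcoefOf_nonneg)
open Summit.QuantumFields.YangMills.Theorems.UV3LargeFieldEnvelopedResummation (largeField_enveloped_adm)
open Summit.QuantumFields.YangMills.Theorems.UV3PinnedCollarBranch
open Summit.QuantumFields.YangMills.Theorems.UV3PinnedStepThroughOfMassEnvelope (near_count_real_le)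
open Summit.QuantumFields.YangMills.Theorems.UV3PinnedStepOrganOfMassEnvelope (pFun_sq_eq restricted_sum_le_through_sums collar_scaleSum_le_at)
open Summit.QuantumFields.YangMills.Theorems.UV3UnitEnvelopeOrganOfMassEnvelopeV3 (smallFactorsAdm_towerOfAC_v3 Zterm_towerOfAC_top_le_booked)

variable {F : T3Family} {𝔠 : AlphaConsts F.L (suGroupModel 2).N} {γ : ℝ} {hγ : 0 < γ} {hγ1 : γ ≤ (min 𝔠.gamma0 1) ^ 2} {K : ℕ}
  (p : AlphaInputsT3AC.PkgAtV3 F 𝔠 γ hγ hγ1 K)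

/-! ## §1 The histories through one candidate, under the envelope (v3 weights) -/

/-- ★★★ **THE HISTORIES THROUGH ONE CANDIDATE, UNDER THE MASS ENVELOPE, v3 WEIGHTS** — the v3 twin of ✓`UV3PinnedStepThroughOfMassEnvelope.through_le_of_massEnvelope`:
`Σ_{r : e ∈ P(r)} wtP_K(r,W)·exp(−mainT_K(r,W) + Zterm_K(r)) ≤ e^{A₁}·exp(−(c₁∕8)·p(g_{e.1})²)·exp((3∕ℓ)·(2L^m)³)` for every candidate `e ∈ allCodes K` and every field `W` at which the
admissible non-trivial histories have `wtP_K(r, W) ≤ e^{A₁}`. [cite: Balaban1985UV3, (41) p.266, (67)–(71) p.273, pp.273–274] -/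
theorem through_le_of_massEnvelope_v3 {A₁ : ℝ} (W : GaugeField (F.P K) K (Matrix.specialUnitaryGroup (Fin 2) ℂ))
    (hW : ∀ r : Hist (F.P K) K,
      Hist.Admissible 𝔠.lane.carrier.M₁ (rcolOf (T3Scales F γ hγ (hγ1.trans (sq_min_one_le _ 𝔠.gamma0_pos)) K) 𝔠.lane.carrier) K r →
      r ≠ Hist.triv (F.P K) K → p.wtP K r W ≤ Real.exp A₁)
    (e : ℕ × PlaqCode (F.P K)) (he : e ∈ allCodes (F.P K) K) :
    ∑ r ∈ (Finset.univ : Finset (Hist (F.P K) K)).filter (fun r => e ∈ Hist.disc r),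
        p.wtP K r W * Real.exp (-(p.T.mainT K r W) + p.T.Zterm K r)
      ≤ Real.exp A₁ *
          Real.exp (-(1 / (4 * ((suGroupModel 2).N : ℝ)) / 8 *
            B10.pFun 𝔠.lane.carrier.b₀ 𝔠.lane.carrier.p₀ ((T3Scales F γ hγ (hγ1.trans (sq_min_one_le _ 𝔠.gamma0_pos)) K).gk e.1) ^ 2)) *
        Real.exp (3 / (Real.log F.L / 2) * (2 * (F.L : ℝ) ^ F.m) ^ 3) := by
  classical
  set S := T3Scales F γ hγ (hγ1.trans (sq_min_one_le _ 𝔠.gamma0_pos)) K with hS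
  have hSK : S.K = K := rfl
  have hL : 2 ≤ F.L := F.hL.2
  have hLr : (2 : ℝ) ≤ F.L := by exact_mod_cast hL
  have hR₁ : 0 ≤ 𝔠.lane.carrier.R₁ := 𝔠.R₁_nonneg
  have hr : 0 ≤ 𝔠.lane.carrier.r₀ := le_trans zero_le_one 𝔠.one_le_r₀
  have hM : 0 < 𝔠.lane.carrier.M₁ := 𝔠.lane.F.M₁_pos
  have hCz : 0 ≤ 𝔠.lane.carrier.Cz + 𝔠.lane.carrier.Cv := add_nonneg 𝔠.Cz_nonneg 𝔠.Cv_nonneg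
  have h5 : 0 ≤ 𝔠.lane.carrier.C₅ := 𝔠.C₅_nonneg
  have h6 : 0 ≤ 𝔠.lane.carrier.C₆ := 𝔠.C₆_nonneg
  have hc₁ : 0 ≤ 𝔠.lane.carrier.c₁ := by show (0 : ℝ) ≤ 3; norm_num
  have hNpos : 0 < (suGroupModel 2).N := (suGroupModel 2).N_pos
  have hg : ∀ i, i ≤ K → 0 < S.gk i ∧ S.gk i ≤ 1 := fun i hi => ⟨gk_pos S i, gk_le_one S S.gK_le_one i hi⟩
  have hlogL : 0 < Real.log F.L := Real.log_pos (by linarith)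
  have hℓ : 0 < Real.log (F.L : ℝ) / 2 := by positivity
  -- the site count at the unit lattice
  have hsites : (Fintype.card (Site (F.P K) K) : ℝ) = (2 * (F.L : ℝ) ^ F.m) ^ 3 := by
    rw [Site.card_site]
    have : (F.P K).sitesPerDir K = 2 * F.L ^ F.m := by simp [Params.sitesPerDir]
    rw [this]
    push_cast
    rfl
  -- the progression of the couplings
  have hx : ∀ i, i ≤ K → xlog (S.gk i) = xlog (S.gk K) + ((K - i : ℕ) : ℝ) * (Real.log F.L / 2) := by
    intro i hi
    rw [gk_eq_gRun_norm S i, gk_eq_gRun_norm S K]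
    exact xlog_gRun 1 (F.L : ℝ) S.g0sq one_pos (by linarith) (g0sq_pos S) hi
  -- the sign of `A` and the provisos
  have hA : 0 ≤ (𝔠.lane.carrier.Cz + 𝔠.lane.carrier.Cv) + 𝔠.lane.carrier.C₅ + 𝔠.lane.carrier.C₆ +
      (|𝔠.lane.carrier.logσ₀| + 𝔠.lane.carrier.dg) * 𝔠.lane.carrier.c₁ := by
    have := 𝔠.lane.carrier.dg_nonneg
    have := abs_nonneg 𝔠.lane.carrier.logσ₀
    positivity
  have hp := prov_hp 𝔠
  have hb₁ := prov_hb₁ 𝔠 hNpos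
  have hb₂ := prov_hb₂ 𝔠 hNpos
  have hcL : 𝔠.lane.consts.L = (F.L : ℝ) := rfl
  rw [hcL] at hb₁
  have hMr : (1 : ℝ) ≤ 𝔠.lane.carrier.M₁ := by exact_mod_cast hM
  have hcg : (0 : ℝ) ≤ (2 * (2 * ((𝔠.lane.carrier.R₁ + 1) * 𝔠.lane.carrier.M₁) +
      2 * ((F.L : ℝ) * (3 * ((𝔠.lane.carrier.M₁ : ℝ) - 1)) + 3 * ((F.L : ℝ) - 1)) + 20)) * 1 := by
    have h1 : (0 : ℝ) ≤ (𝔠.lane.carrier.R₁ + 1) * 𝔠.lane.carrier.M₁ := by positivity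
    have h2 : (0 : ℝ) ≤ (F.L : ℝ) * (3 * ((𝔠.lane.carrier.M₁ : ℝ) - 1)) := by nlinarith
    nlinarith
  refine (largeField_enveloped_adm (k := K) (K := K) le_rfl S.gk (b₀ := 𝔠.lane.carrier.b₀) (p₀ := 𝔠.lane.carrier.p₀)
    (A := (𝔠.lane.carrier.Cz + 𝔠.lane.carrier.Cv) + 𝔠.lane.carrier.C₅ + 𝔠.lane.carrier.C₆ +
      (|𝔠.lane.carrier.logσ₀| + 𝔠.lane.carrier.dg) * 𝔠.lane.carrier.c₁) (A₀ := 0)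
    (c₁ := 1 / (4 * ((suGroupModel 2).N : ℝ))) (gs := 1)
    (cg := 2 * (2 * ((𝔠.lane.carrier.R₁ + 1) * 𝔠.lane.carrier.M₁) + 2 * ((F.L : ℝ) * (3 * ((𝔠.lane.carrier.M₁ : ℝ) - 1)) + 3 * ((F.L : ℝ) - 1)) + 20))
    (ρ := 1) (r₀ := 𝔠.lane.carrier.r₀) (ℓ := Real.log F.L / 2) (xK := xlog (S.gk K)) (S := (2 * (F.L : ℝ) ^ F.m) ^ 3)
    (σ := 3 * Real.log F.L) (Menv := Real.exp A₁)
    (allCodes (F.P K) K) (fun e he => Hist.disc_lt _ e he) ?cardE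
    ((Finset.univ : Finset (Hist (F.P K) K)).filter (fun r => e ∈ Hist.disc r))
    (Hist.Admissible 𝔠.lane.carrier.M₁ (rcolOf S 𝔠.lane.carrier) K) Hist.disc
    (fun r _ _ => Hist.disc_subset_allCodes r) ((Hist.disc_injective K).injOn.mono (Set.subset_univ _))
    (fun r => p.wtP K r W) (fun r => p.T.mainT K r W) (fun r => p.T.Zterm K r)
    (fun i Q => ∑ e ∈ Q.filter (fun e => e.1 ≤ i),
      (2 * (2 * ((𝔠.lane.carrier.R₁ + 1) * 𝔠.lane.carrier.M₁) + 2 * ((F.L : ℝ) * (3 * ((𝔠.lane.carrier.M₁ : ℝ) - 1)) + 3 * ((F.L : ℝ) - 1)) + 20) * 1) ^ 3 *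
        xlog (S.gk e.1) ^ (3 * 𝔠.lane.carrier.r₀))
    (Real.exp_pos _).le ?madm ?menv ?sf ?zt (fun Q _ i _ => le_rfl)
    hA le_rfl (by positivity) hcg hr hℓ (by positivity) hg le_rfl hx hp ?b1 ?b2).2 e he ?pin
  case cardE =>
    intro i hi
    have h := card_filter_allCodes_le_exp (P := F.P K) rfl hi (by show K ≤ F.m + K; omega)
    rw [hsites] at h
    exact h
  case madm =>
    intro r _ hna
    exact PinnedStep.wtP_eq_zero_of_not_admissible 𝔠.lane p.X (AlphaInputsT3AC.admWindowT3 F 𝔠 γ hγ hγ1 K) K r W hna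
  case menv =>
    intro r hr' hadm
    rw [zero_mul, Real.exp_zero, mul_one]
    have hmem : e ∈ Hist.disc r := (Finset.mem_filter.mp hr').2
    have hne : r ≠ Hist.triv (F.P K) K := by
      rintro rfl
      rw [Hist.disc_triv] at hmem
      exact Finset.notMem_empty e hmem
    exact hW r hadm hne
  case sf =>
    intro r _ hadm
    exact smallFactorsAdm_towerOfAC_v3 (T3Scales_window F 𝔠 γ hγ hγ1 K) hL p.run K le_rfl W r hadm
  case zt =>
    intro r _ _
    exact Zterm_towerOfAC_top_le_booked (hγ1 := hγ1) p.X p.𝔖 r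
  case b1 =>
    simpa using hb₁
  case b2 =>
    nlinarith [hb₂, hlogL]
  case pin =>
    intro r hr' _
    exact (Finset.mem_filter.mp hr').2

/-! ## §2 The restricted sum of `hSii`(v3) -/

set_option maxHeartbeats 400000 in
open Classical in
/-- ★★★ **THE RESTRICTED SUM OF (S-ii), `dV_K`-POINTWISE UNDER THE ENVELOPE**: at the package's data, for `1 ≤ j < K`, a level-`j` plaquette `a` and a unit-lattice field `W` at which every
admissible non-trivial history has mass `≤ e^{A₁}`, the (41)_K history sum RESTRICTED to «`a ∈ P_j(r)` ∨ `¬ plaqCover a ⊆ Ω_j(r↾j)`» is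
`≤ exp(A₁ + (3∕ℓ)(2L^m)³ + log(1 + C_coll∕ℓ))·exp(−(c₁∕16)·p(g_j)²)`, `g_j = √(γL^{−(K−j)})`, `c₁ = 1∕(4N)`: the v1 file's mass-free domination ✓`restricted_sum_le_through_sums` and collar scale sum ✓`collar_scaleSum_le_at`, §1 per candidate
(`through_le_of_massEnvelope_v3`). [cite: Balaban1985UV3, (38)–(41) p.266, (67)–(71) p.273, pp.273–274] -/
theorem pinnedLF_le_of_massEnvelope_v3 {A₁ : ℝ} {j : ℕ} (hjK : j < K) (a : Plaq (F.P K) j)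
    (W : GaugeField (F.P K) K (Matrix.specialUnitaryGroup (Fin 2) ℂ))
    (hW : ∀ r : Hist (F.P K) K,
      Hist.Admissible 𝔠.lane.carrier.M₁ (rcolOf (T3Scales F γ hγ (hγ1.trans (sq_min_one_le _ 𝔠.gamma0_pos)) K) 𝔠.lane.carrier) K r →
      r ≠ Hist.triv (F.P K) K → p.wtP K r W ≤ Real.exp A₁) :
    ∑ r ∈ (Finset.univ : Finset (Hist (F.P K) K)).filter (fun r : Hist (F.P K) K =>
        a ∈ r ⟨j, hjK⟩ ∨ ¬ plaqCover a ⊆ Omega 𝔠.lane.carrier.M₁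
          (rcolOf (T3Scales F γ hγ (hγ1.trans (sq_min_one_le _ 𝔠.gamma0_pos)) K) 𝔠.lane.carrier) j
          (fun i : Fin j => r (Fin.castLE hjK.le i)) j),
      p.wtP K r W * Real.exp (-(p.T.mainT K r W) + p.T.Zterm K r) ≤
    Real.exp (A₁ + 3 / (Real.log F.L / 2) * (2 * (F.L : ℝ) ^ F.m) ^ 3 +
        Real.log (1 + 9 * (2 * (2 * ((𝔠.lane.carrier.R₁ + 1) * 𝔠.lane.carrier.M₁) +
          2 * ((F.L : ℝ) * (3 * ((𝔠.lane.carrier.M₁ : ℝ) - 1)) + 3 * ((F.L : ℝ) - 1)) + 15 * F.L + 7) + 6) ^ 3 / (Real.log F.L / 2))) *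
      Real.exp (-(1 / (4 * ((suGroupModel 2).N : ℝ)) / 16 *
        B10.pFun 𝔠.b₀ 𝔠.p₀ (Real.sqrt (γ * ((F.L : ℝ)⁻¹) ^ (K - j))) ^ 2)) := by
  set S := T3Scales F γ hγ (hγ1.trans (sq_min_one_le _ 𝔠.gamma0_pos)) K with hS
  set ℓ : ℝ := Real.log F.L / 2 with hℓdef
  set Sm : ℝ := (2 * (F.L : ℝ) ^ F.m) ^ 3 with hSm
  set c₁ : ℝ := 1 / (4 * ((suGroupModel 2).N : ℝ)) with hc₁def
  set Ccoll : ℝ := 9 * (2 * (2 * ((𝔠.lane.carrier.R₁ + 1) * 𝔠.lane.carrier.M₁) +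
    2 * ((F.L : ℝ) * (3 * ((𝔠.lane.carrier.M₁ : ℝ) - 1)) + 3 * ((F.L : ℝ) - 1)) + 15 * F.L + 7) + 6) ^ 3 with hCcoll
  have hL : 2 ≤ F.L := F.hL.2
  have hLr : (2 : ℝ) ≤ F.L := by exact_mod_cast hL
  have hMr : (1 : ℝ) ≤ 𝔠.lane.carrier.M₁ := by exact_mod_cast 𝔠.lane.F.M₁_pos
  have hc₁0 : 0 ≤ c₁ := by rw [hc₁def]; positivity
  have hlogL : 0 < Real.log F.L := Real.log_pos (by linarith)
  have hℓ : 0 < ℓ := by rw [hℓdef]; positivity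
  have hg : ∀ i, i ≤ K → 0 < S.gk i ∧ S.gk i ≤ 1 := fun i hi => ⟨gk_pos S i, gk_le_one S S.gK_le_one i hi⟩
  have hR₁ : 0 ≤ 𝔠.lane.carrier.R₁ := 𝔠.R₁_nonneg
  have hCcoll0 : 0 ≤ Ccoll := by
    have h1 : (0 : ℝ) ≤ (𝔠.lane.carrier.R₁ + 1) * 𝔠.lane.carrier.M₁ := mul_nonneg (by linarith) (by linarith)
    have h2 : (0 : ℝ) ≤ (F.L : ℝ) * (3 * ((𝔠.lane.carrier.M₁ : ℝ) - 1)) := by nlinarith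
    rw [hCcoll]; exact mul_nonneg (by norm_num) (pow_nonneg (by nlinarith) 3)
  -- the summand, the per-candidate sums, and §2 in `κ·x^{2p₀}` form
  set f : Hist (F.P K) K → ℝ := fun r =>
    p.wtP K r W * Real.exp (-(p.T.mainT K r W) + p.T.Zterm K r) with hf
  have hf0 : ∀ r, 0 ≤ f r := fun r =>
    mul_nonneg (PinnedStep.wtP_nonneg_le 𝔠.lane p.X (AlphaInputsT3AC.admWindowT3 F 𝔠 γ hγ hγ1 K) K r W).1 (Real.exp_pos _).le
  have hθ : ∀ i, i ≤ K → c₁ / 8 * B10.pFun 𝔠.lane.carrier.b₀ 𝔠.lane.carrier.p₀ (S.gk i) ^ 2 =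
      c₁ * 𝔠.lane.carrier.b₀ ^ 2 / 8 * xlog (S.gk i) ^ (2 * 𝔠.lane.carrier.p₀) :=
    fun i hi => (pFun_sq_eq (c₁ := c₁) (b₀ := 𝔠.lane.carrier.b₀) (p₀ := 𝔠.lane.carrier.p₀) (hg i hi).1 (hg i hi).2).2.1
  have hTle : ∀ e ∈ allCodes (F.P K) K, ∑ r ∈ (Finset.univ : Finset (Hist (F.P K) K)).filter (fun r => e ∈ Hist.disc r), f r ≤
      Real.exp A₁ * Real.exp (-(c₁ * 𝔠.lane.carrier.b₀ ^ 2 / 8 * xlog (S.gk e.1) ^ (2 * 𝔠.lane.carrier.p₀))) * Real.exp (3 / ℓ * Sm) := by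
    intro e he
    have h := through_le_of_massEnvelope_v3 p W hW e he
    rw [hθ e.1 (Hist.disc_lt _ e he).le] at h
    exact h
  -- the three pieces
  have hsplit := restricted_sum_le_through_sums (𝔠 := 𝔠) (γ := γ) (hγ := hγ) (hγ1 := hγ1) hjK a f hf0
  have hcollar := collar_scaleSum_le_at (𝔠 := 𝔠) (γ := γ) (hγ := hγ) (hγ1 := hγ1) hjK a
  have he₀E : ((j : ℕ), plaqCode a) ∈ allCodes (F.P K) K := (Hist.mem_disc _ _).2 ⟨⟨j, hjK⟩, a, Finset.mem_univ _, rfl⟩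
  have hpin : ∑ r ∈ (Finset.univ : Finset (Hist (F.P K) K)).filter (fun r => ((j : ℕ), plaqCode a) ∈ Hist.disc r), f r ≤
      Real.exp A₁ * Real.exp (3 / ℓ * Sm) * Real.exp (-(c₁ * 𝔠.lane.carrier.b₀ ^ 2 / 8 / 2 * xlog (S.gk j) ^ (2 * 𝔠.lane.carrier.p₀))) := by
    have h := hTle _ he₀E
    have hmono : Real.exp (-(c₁ * 𝔠.lane.carrier.b₀ ^ 2 / 8 * xlog (S.gk j) ^ (2 * 𝔠.lane.carrier.p₀))) ≤
        Real.exp (-(c₁ * 𝔠.lane.carrier.b₀ ^ 2 / 8 / 2 * xlog (S.gk j) ^ (2 * 𝔠.lane.carrier.p₀))) := by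
      apply Real.exp_le_exp.mpr
      have h0 : 0 ≤ xlog (S.gk j) ^ (2 * 𝔠.lane.carrier.p₀) := Real.rpow_nonneg (le_trans zero_le_one (one_le_xlog (hg j hjK.le).1 (hg j hjK.le).2)) _
      have h1 : 0 ≤ c₁ * 𝔠.lane.carrier.b₀ ^ 2 / 8 := by positivity
      nlinarith [mul_nonneg h1 h0]
    calc _ ≤ Real.exp A₁ * Real.exp (-(c₁ * 𝔠.lane.carrier.b₀ ^ 2 / 8 * xlog (S.gk j) ^ (2 * 𝔠.lane.carrier.p₀))) * Real.exp (3 / ℓ * Sm) := h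
      _ ≤ Real.exp A₁ * Real.exp (-(c₁ * 𝔠.lane.carrier.b₀ ^ 2 / 8 / 2 * xlog (S.gk j) ^ (2 * 𝔠.lane.carrier.p₀))) * Real.exp (3 / ℓ * Sm) :=
          mul_le_mul_of_nonneg_right (mul_le_mul_of_nonneg_left hmono (Real.exp_pos _).le) (Real.exp_pos _).le
      _ = _ := by ring
  have hcollT : ∑ i ∈ Finset.range j, ∑ q ∈ (Finset.univ : Finset (Plaq (F.P K) i)).filter (fun q => ∃ c ∈ plaqCover q, ∃ y ∈ plaqCover a,
          sdist (j - 1) c y ≤ 2 * (rcolOf S 𝔠.lane.carrier i +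
            ((F.P K).L * ((F.P K).d * (𝔠.lane.carrier.M₁ - 1)) + (F.P K).d * ((F.P K).L - 1)) + (F.P K).d) + 1),
        ∑ r ∈ (Finset.univ : Finset (Hist (F.P K) K)).filter (fun r => ((i : ℕ), plaqCode q) ∈ Hist.disc r), f r ≤
      Real.exp A₁ * Real.exp (3 / ℓ * Sm) * (Ccoll / ℓ * Real.exp (-(c₁ * 𝔠.lane.carrier.b₀ ^ 2 / 8 / 2 * xlog (S.gk j) ^ (2 * 𝔠.lane.carrier.p₀)))) := by
    refine le_trans (Finset.sum_le_sum fun i hi => Finset.sum_le_sum fun q _ =>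
      hTle ((i : ℕ), plaqCode q) ((Hist.mem_disc _ _).2 ⟨⟨i, (Finset.mem_range.mp hi).trans hjK⟩, q, Finset.mem_univ _, rfl⟩)) ?_
    have hrew : ∀ i ∈ Finset.range j, ∑ q ∈ (Finset.univ : Finset (Plaq (F.P K) i)).filter (fun q => ∃ c ∈ plaqCover q, ∃ y ∈ plaqCover a,
          sdist (j - 1) c y ≤ 2 * (rcolOf S 𝔠.lane.carrier i +
            ((F.P K).L * ((F.P K).d * (𝔠.lane.carrier.M₁ - 1)) + (F.P K).d * ((F.P K).L - 1)) + (F.P K).d) + 1),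
        Real.exp A₁ * Real.exp (-(c₁ * 𝔠.lane.carrier.b₀ ^ 2 / 8 * xlog (S.gk i) ^ (2 * 𝔠.lane.carrier.p₀))) * Real.exp (3 / ℓ * Sm) =
        Real.exp A₁ * Real.exp (3 / ℓ * Sm) * ((((Finset.univ : Finset (Plaq (F.P K) i)).filter (fun q => ∃ c ∈ plaqCover q, ∃ y ∈ plaqCover a,
          sdist (j - 1) c y ≤ 2 * (rcolOf S 𝔠.lane.carrier i +
            ((F.P K).L * ((F.P K).d * (𝔠.lane.carrier.M₁ - 1)) + (F.P K).d * ((F.P K).L - 1)) + (F.P K).d) + 1)).card : ℝ) *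
          Real.exp (-(c₁ * 𝔠.lane.carrier.b₀ ^ 2 / 8 * xlog (S.gk i) ^ (2 * 𝔠.lane.carrier.p₀)))) := by
      intro i _
      rw [Finset.sum_const, nsmul_eq_mul]; ring
    rw [Finset.sum_congr rfl hrew, ← Finset.mul_sum]
    exact mul_le_mul_of_nonneg_left hcollar (by positivity)
  -- the rate in the stub's letter and the constant
  have hrate : c₁ * 𝔠.lane.carrier.b₀ ^ 2 / 8 / 2 * xlog (S.gk j) ^ (2 * 𝔠.lane.carrier.p₀) =
      c₁ / 16 * B10.pFun 𝔠.b₀ 𝔠.p₀ (Real.sqrt (γ * ((F.L : ℝ)⁻¹) ^ (K - j))) ^ 2 := by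
    rw [← T3Scales_gk_eq F γ hγ (hγ1.trans (sq_min_one_le _ 𝔠.gamma0_pos)) K j hjK.le]
    exact ((pFun_sq_eq (c₁ := c₁) (b₀ := 𝔠.lane.carrier.b₀) (p₀ := 𝔠.lane.carrier.p₀) (hg j hjK.le).1 (hg j hjK.le).2).2.2).symm
  have hexpCZ : Real.exp (A₁ + 3 / ℓ * Sm + Real.log (1 + Ccoll / ℓ)) = Real.exp A₁ * Real.exp (3 / ℓ * Sm) * (1 + Ccoll / ℓ) := by
    rw [Real.exp_add, Real.exp_add, Real.exp_log (by positivity)]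
  calc _ ≤ _ := hsplit
    _ ≤ Real.exp A₁ * Real.exp (3 / ℓ * Sm) * Real.exp (-(c₁ * 𝔠.lane.carrier.b₀ ^ 2 / 8 / 2 * xlog (S.gk j) ^ (2 * 𝔠.lane.carrier.p₀))) +
        Real.exp A₁ * Real.exp (3 / ℓ * Sm) * (Ccoll / ℓ * Real.exp (-(c₁ * 𝔠.lane.carrier.b₀ ^ 2 / 8 / 2 * xlog (S.gk j) ^ (2 * 𝔠.lane.carrier.p₀)))) :=
        add_le_add hpin hcollT
    _ = Real.exp (A₁ + 3 / ℓ * Sm + Real.log (1 + Ccoll / ℓ)) * Real.exp (-(c₁ / 16 *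
        B10.pFun 𝔠.b₀ 𝔠.p₀ (Real.sqrt (γ * ((F.L : ℝ)⁻¹) ^ (K - j))) ^ 2)) := by rw [hexpCZ, ← hrate]; ring


/-! ## §3 The (S-ii)ᵥ₃ row of record from hJ(v3) -/

open Classical in
/-- ★★★ **THE ORGAN ROW (S-ii) `hSii` OF R-19936-S OVER THE v3 SOCKET (✓p753361 `UV3PinnedStepKnitOfPackageV3`'s `AlphaInputsT3AC.OfV3At.pinnedTop_of_pinnedLF` binder, VERBATIM) FROM hJ(v3).**  Per family `F`,
record `𝔠`, socket `h : Of F 𝔠`, coupling `γ` in the window and depth `m`: IF (hJ) there is `A₁` such that for every run `K` and every ADMISSIBLE NON-TRIVIAL history `r` the lane's mass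
PINNED mass `massP_K(r, ·) = massRecP …` of the v3 package's data is `≤ e^{A₁}` `dV_K`-a.e. — hJ(v3), the top-level a.e. envelope of the K-fold transported pinned masses of
`blockAvg ℰp` (print: `≤ 1` by Haar compatibility; tree: the k-fold Jacobian row, lit GAPS G-B10-10(c), OPEN; no trivial-history floor in this currency) — THEN `hSii`(v3) holds with
`CZ := A₁ + (6∕log L)(2L^m)³ + log(1 + C_coll∕ℓ)`, `c := 1∕(64N)`, `A := 0` (the windowed weights `wtP ≤ massP`, ✓`PinnedStep.wtP_nonneg_le`; §2 `pinnedLF_le_of_massEnvelope_v3`).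
With ✓p753361 and ✓p749641: `stub_pinnedStep` ⟸ v3 socket (guarded, `∀ L > 1`) + hJ(v3) — no `hMain`.
[cite: Balaban1985UV3, (41) p.266, (67)–(71) p.273, pp.273–274, (7) p.257] -/
theorem _root_.Summit.QuantumFields.YangMills.Theorems.AlphaInputsT3AC.OfV3At.hSii_of_massEnvelope {a₀ a₁ : ℝ} (h : AlphaInputsT3AC.OfV3At F 𝔠 a₀ a₁)
    (hc : 0 < a₀ ∧ 0 < a₁ ∧ 𝔠.B₃ * a₁ ≤ a₀) (γ : ℝ) (hγ : 0 < γ) (hγ1 : γ ≤ (min 𝔠.gamma0 1) ^ 2) (m : ℕ)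
    (hJ : ∃ A₁ : ℝ, ∀ (K : ℕ) (r : Hist (F.P K) K),
      Hist.Admissible 𝔠.lane.carrier.M₁ (rcolOf (T3Scales F γ hγ (hγ1.trans (sq_min_one_le _ 𝔠.gamma0_pos)) K) 𝔠.lane.carrier) K r →
      r ≠ Hist.triv (F.P K) K →
      ∀ᵐ W ∂(fieldMeasure (F.P K) K (Matrix.specialUnitaryGroup (Fin 2) ℂ)),
        PinnedStep.massP 𝔠.lane (h.pkgAtV3 hc γ hγ hγ1 K).X K r W ≤ Real.exp A₁) :
    ∃ (CZ c : ℝ) (A : ℕ), 0 < c ∧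
      ∀ (K j : ℕ) (hj1 : 1 ≤ j) (hjK : j + 2 ≤ K), j + (K - 1) / m ≤ K → ∀ (a : Plaq (F.P K) j),
        ∀ᵐ W ∂(fieldMeasure (F.P K) K (Matrix.specialUnitaryGroup (Fin 2) ℂ)),
        ∑ r ∈ Finset.univ.filter (fun r : Hist (F.P K) K =>
            a ∈ r ⟨j, by omega⟩ ∨ ¬ plaqCover a ⊆ Omega 𝔠.lane.carrier.M₁
              (rcolOf (T3Scales F γ hγ (hγ1.trans (sq_min_one_le _ 𝔠.gamma0_pos)) K) 𝔠.lane.carrier) j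
              (fun i : Fin j => r (Fin.castLE (by omega) i)) j),
          (h.pkgAtV3 hc γ hγ hγ1 K).wtP K r W *
            Real.exp (-((h.pkgAtV3 hc γ hγ hγ1 K).T.mainT K r W) + (h.pkgAtV3 hc γ hγ hγ1 K).T.Zterm K r) ≤
        Real.exp CZ * ((F.scheme ℰp γ).β (K - j) ^ A *
          Real.exp (-(c * B10.pFun 𝔠.b₀ 𝔠.p₀ (Real.sqrt (γ * ((F.L : ℝ)⁻¹) ^ (K - j))) ^ 2))) := by
  obtain ⟨A₁, hA⟩ := hJ
  have hNpos : (0 : ℝ) < ((suGroupModel 2).N : ℝ) := by exact_mod_cast (suGroupModel 2).N_pos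
  refine ⟨A₁ + 3 / (Real.log F.L / 2) * (2 * (F.L : ℝ) ^ F.m) ^ 3 +
      Real.log (1 + 9 * (2 * (2 * ((𝔠.lane.carrier.R₁ + 1) * 𝔠.lane.carrier.M₁) +
        2 * ((F.L : ℝ) * (3 * ((𝔠.lane.carrier.M₁ : ℝ) - 1)) + 3 * ((F.L : ℝ) - 1)) + 15 * F.L + 7) + 6) ^ 3 / (Real.log F.L / 2)),
    1 / (4 * ((suGroupModel 2).N : ℝ)) / 16, 0, by positivity, fun K j hj1 hjK _ a => ?_⟩
  -- gather the finitely many a.e. envelopes of run `K`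
  have hae : ∀ᵐ W ∂(fieldMeasure (F.P K) K (Matrix.specialUnitaryGroup (Fin 2) ℂ)), ∀ r : Hist (F.P K) K,
      Hist.Admissible 𝔠.lane.carrier.M₁ (rcolOf (T3Scales F γ hγ (hγ1.trans (sq_min_one_le _ 𝔠.gamma0_pos)) K) 𝔠.lane.carrier) K r →
      r ≠ Hist.triv (F.P K) K → (h.pkgAtV3 hc γ hγ hγ1 K).wtP K r W ≤ Real.exp A₁ := by
    refine ae_all_iff.2 fun r => ?_
    have hwt : ∀ W, (h.pkgAtV3 hc γ hγ hγ1 K).wtP K r W ≤ PinnedStep.massP 𝔠.lane (h.pkgAtV3 hc γ hγ hγ1 K).X K r W := fun W =>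
      (PinnedStep.wtP_nonneg_le 𝔠.lane (h.pkgAtV3 hc γ hγ hγ1 K).X (AlphaInputsT3AC.admWindowT3 F 𝔠 γ hγ hγ1 K) K r W).2
    by_cases hadm : Hist.Admissible 𝔠.lane.carrier.M₁
      (rcolOf (T3Scales F γ hγ (hγ1.trans (sq_min_one_le _ 𝔠.gamma0_pos)) K) 𝔠.lane.carrier) K r
    · by_cases hne : r = Hist.triv (F.P K) K
      · exact Filter.Eventually.of_forall fun W _ h2 => absurd hne h2
      · filter_upwards [hA K r hadm hne] with W hW
        exact fun _ _ => (hwt W).trans hW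
    · exact Filter.Eventually.of_forall fun W h1 _ => absurd h1 hadm
  filter_upwards [hae] with W hW
  rw [pow_zero, one_mul]
  exact pinnedLF_le_of_massEnvelope_v3 (h.pkgAtV3 hc γ hγ hγ1 K) (by omega) a W hW

end Summit.QuantumFields.YangMills.Theorems.UV3PinnedStepOrganOfMassEnvelopeV3

end
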